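import Literature.AlgebraicGeometry.HodgeTheory.ClassesSupportedOnComplexification
import HarnessLib

/-!
# Sub-Hodge structures of the Hodge structure of a Hodge model; compatibility with the Hodge
# filtration of the tree

Family `hodge`, layer `Literature/AlgebraicGeometry/HodgeTheory`. Companion to
`HodgeStructureOfHodgeModel`, which CONSTRUCTS, for a smooth projective complex variety `X` and a
Hodge symmetric Hodge model `A`, the pure `ℚ`-Hodge structure `A.hodgeStructure hX hA k` of weight
`k` on `Hᵏ(X(ℂ); ℚ)` (`Fʳ = Θ_A⁻¹(⨁_{p ≥ r} H^{p,k-p})` on `ℂ ⊗_ℚ Hᵏ(X(ℂ); ℚ)`, pieces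
`Θ_A⁻¹(H^{p,q}) = HodgeModel.ratPiece`). Two further properties consumed by statements phrased
"relative to a Hodge structure on `Hᵏ(–(ℂ); ℚ)`" (`SaitoGrFDeRhamCurveNetClassical`,
`GysinHodgeClassLiftProofs`, `RelativeCohomologyMHS`) are PROVED here:

* **Compatibility with the tree's Hodge filtration** (`HodgeModel.mem_map_hodgeStructure_F_iff`):
  a complex class `c ∈ Hᵏ(X(ℂ); ℂ)` lies in `β(Fʳ)` — the image of `Fʳ` under the complexification
  `β = ofRatClassBaseChange : Hᵏ(X(ℂ); ℚ) ⊗ ℂ → Hᵏ(X(ℂ); ℂ)` — iff its pull-back to the model lies in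
  `Fʳ Hᵏ(X^an; ℂ)` (`HodgeModel.hodgeFiltration`); hence, GRANTED the named fact
  `hodgePQ_independent_of_hodgeModel` (all models induce the same filtration), every class that is
  `IsInHodgeFiltration` (`∃` over models) lies in `β(Fʳ)`
  (`HodgeModel.mem_map_hodgeStructure_F_of_isInHodgeFiltration`; Voisin I §7.1.1).
* **Sub-Hodge structures from "stable under the decomposition into types"**
  (`HodgeModel.exists_subHodgeStructure_of_decomposition`): a `ℚ`-subspace `K ⊆ Hᵏ(X(ℂ); ℚ)`
  whose complexification `K ⊗ ℂ ⊆ ℂ ⊗ Hᵏ(X(ℂ); ℚ)` is the sum of its intersections with the pieces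
  `Θ_A⁻¹(H^{p,q})` underlies a `SubHodgeStructure` of `A.hodgeStructure` (Voisin I, §7.3.1: a
  sub-Hodge structure is "a `ℚ`-vector subspace which, when tensored with `ℂ`, has a Hodge
  decomposition induced by that of" the ambient one, Def. 7.24). This is the tree's general
  constructor `Motives.HodgeStructure.SubHodgeStructure.exists_eq_of_baseChange_le`
  (`Motives/HodgeStructureSubstructures`) once the pieces `V^{p,k-p}` of `A.hodgeStructure` are
  identified with `Θ_A⁻¹(H^{p,k-p})` (`HodgeModel.piece_eq_ratPiece`); nothing is re-proved here.
  The hypothesis is also accepted ON THE MODEL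
  (`HodgeModel.baseChange_eq_iSup_of_map_pullback`), verbatim the unfolded predicate
  `HodgeModel.IsSubHodge A k (W.map (A.pullback k))` of the barrier catalogue
  (`Literature/Barriers/HodgeConjecture/…SubHodge`, kept downstream), with `W = β(K ⊗ ℂ)`.
* In particular (`HodgeModel.exists_subHodgeStructure_ratClassesSupportedOn_of_model`): GIVEN
  Deligne's theorem in the complexified per-kernel form `hK` of that catalogue — for `Z ⊆ X` the
  span of the rational classes killed by `Hᵏ(X(ℂ); ℂ) → Hᵏ((X ∖ Z)(ℂ); ℂ)`, pulled back to the model,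
  is the sum of its intersections with the `H^{p,q}` (C. Voisin, *Chow Rings …* (2014), Thm. 2.39:
  "`Ker (j* : Hᵏ_B(X, ℚ) → Hᵏ_B(X ∖ Y, ℚ))` … is a sub-Hodge structure"; Hodge II Cor. 3.2.17;
  deliberately not a named fact, D-0026) — the rational kernel `ratClassesSupportedOn X Z k`
  underlies a sub-Hodge structure of `A.hodgeStructure`, its complexification being
  `classesSupportedOn X Z k` (`map_baseChange_ratClassesSupportedOn`).

No named fact is introduced; `hodgePQ_independent_of_hodgeModel` and the decomposition
hypotheses are explicit hypotheses.

## References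

* [VoisinHodgeI2002] C. Voisin, Hodge Theory and Complex Algebraic Geometry I, CUP 2002, §7.1.1,
  §7.3.1 (Def. 7.24 and the remark after Lemma 7.26).
* [VoisinChowRings2014] C. Voisin, Chow Rings, Decomposition of the Diagonal, and the Topology of
  Families, Ann. of Math. Stud. 187 (2014), Thm. 2.39.
* [DeligneHodgeII1971] P. Deligne, Théorie de Hodge II, Publ. Math. IHÉS 40 (1971), 1.2.5, 2.1.4,
  Cor. 3.2.17.
* [GrothendieckTopology1969] A. Grothendieck, Hodge's general conjecture is false for trivial
  reasons, Topology 8 (1969), p. 300.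
-/

noncomputable section

open scoped TensorProduct
open CategoryTheory AlgebraicGeometry
open Literature.AlgebraicTopology.SingularHomology
open Literature.AlgebraicGeometry.Motives (ofRatClassBaseChange ofRatClassBaseChange_tmul)

namespace Literature.AlgebraicGeometry.HodgeTheory

section HodgeTheory

/-! ### Reindexing -/

section Reindex

/-- Reindexing a sum over `p + q = k` by the antidiagonal. [folklore] -/
theorem iSup_antidiagonal_eq_iSup {β : Type*} [CompleteLattice β] (k : ℕ) (f : ℕ → ℕ → β) :
    ⨆ pq : ↥(Finset.antidiagonal k), f pq.1.1 pq.1.2 = ⨆ (p : ℕ) (q : ℕ) (_ : p + q = k), f p q := by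
  refine le_antisymm (iSup_le fun pq ↦ ?_) (iSup_le fun p ↦ iSup_le fun q ↦ iSup_le fun h ↦ ?_)
  · exact le_iSup_of_le pq.1.1 (le_iSup_of_le pq.1.2
      (le_iSup_of_le (Finset.mem_antidiagonal.1 pq.2) le_rfl))
  · exact le_iSup (fun pq : ↥(Finset.antidiagonal k) ↦ f pq.1.1 pq.1.2)
      ⟨(p, q), Finset.mem_antidiagonal.2 h⟩

end Reindex

namespace HodgeModel

variable {n : ℕ} {X : Motives.SchemeOver ℂ} (A : HodgeModel n X) (hX : Motives.IsSmoothProjective n X)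

/-! ### Compatibility with the tree's Hodge filtration -/

/-- **`β(Fʳ) = Fʳ`**: a complex class lies in the image under `β = ofRatClassBaseChange` of `Fʳ` of
`A.hodgeStructure` iff its pull-back to the model lies in `Fʳ Hᵏ(X^an; ℂ)` (`β` is onto for `X`
smooth projective, and `Fʳ = Θ_A⁻¹(Fʳ Hᵏ(X^an))` with `Θ_A = (pull-back) ∘ β`).
[cite: VoisinHodgeI2002, §7.1.1] -/
theorem mem_map_hodgeStructure_F_iff (hA : A.IsHodgeSymmetric) (k : ℕ) (r : ℤ)
    (c : complexBetti X k) :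
    c ∈ ((A.hodgeStructure hX hA k).F r).map (ofRatClassBaseChange (Motives.ComplexPoints X) k) ↔
      A.pullback k c ∈ A.hodgeFiltration k r.toNat := by
  constructor
  · rintro ⟨t, ht, rfl⟩
    exact ht
  · intro hc
    obtain ⟨t, rfl⟩ := ofRatClassBaseChange_surjective hX k c
    exact ⟨t, hc, rfl⟩

/-- **Compatibility with `IsInHodgeFiltration`** (hypothesis (H3) of
`SaitoGrFDeRhamCurveNetClassical`): GRANTED the named fact `hodgePQ_independent_of_hodgeModel`, a
class lying in `Fʳ` of SOME Hodge model lies in `β(Fʳ)` of `A.hodgeStructure`.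
[cite: VoisinHodgeI2002, §7.1.1 and §7.3.2] -/
theorem mem_map_hodgeStructure_F_of_isInHodgeFiltration (hI : hodgePQ_independent_of_hodgeModel)
    (hA : A.IsHodgeSymmetric) (k : ℕ) {r : ℕ} {c : complexBetti X k}
    (hc : IsInHodgeFiltration n X k r c) :
    c ∈ ((A.hodgeStructure hX hA k).F r).map (ofRatClassBaseChange (Motives.ComplexPoints X) k) :=
  (A.mem_map_hodgeStructure_F_iff hX hA k r c).2 (by
    rw [Int.toNat_natCast]
    exact (hodgePQ_independent_of_hodgeModel.isInHodgeFiltration_iff hI hX A).1 hc)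

/-- Conversely a class of `β(Fʳ)` is `IsInHodgeFiltration` (witnessed by `A`; no fact needed).
[cite: VoisinHodgeI2002, §7.1.1] -/
theorem isInHodgeFiltration_of_mem_map_hodgeStructure_F (hA : A.IsHodgeSymmetric) (k : ℕ)
    {r : ℕ} {c : complexBetti X k}
    (hc : c ∈ ((A.hodgeStructure hX hA k).F r).map (ofRatClassBaseChange (Motives.ComplexPoints X) k)) :
    IsInHodgeFiltration n X k r c :=
  ⟨A, by simpa only [Int.toNat_natCast] using (A.mem_map_hodgeStructure_F_iff hX hA k r c).1 hc⟩

/-! ### Sub-Hodge structures from "stable under the decomposition into types" -/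

/-- **A `ℚ`-subspace whose complexification is stable under the Hodge decomposition underlies a
sub-Hodge structure** of `A.hodgeStructure`: if `K ⊗ ℂ = ⨁_{p+q=k} (K ⊗ ℂ) ∩ Θ_A⁻¹(H^{p,q})`
(Voisin I §7.3.1, Def. 7.24: "a `ℚ`-vector subspace which, when tensored with `ℂ`, has a Hodge
decomposition induced by that of" the ambient structure), then `K` underlies a sub-Hodge structure.
Immediate from the tree's constructor `SubHodgeStructure.exists_eq_of_baseChange_le` (hypothesis
`K ⊗ ℂ ⊆ Σ_p (K ⊗ ℂ) ∩ V^{p,k-p}`), the pieces of `A.hodgeStructure` being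
`V^{p,q} = Θ_A⁻¹(H^{p,q})` (`piece_eq_ratPiece`). [cite: VoisinHodgeI2002, §7.3.1 Def. 7.24]
[cite: DeligneHodgeII1971, 1.2.5 and 2.1.4] -/
theorem exists_subHodgeStructure_of_decomposition (hA : A.IsHodgeSymmetric) (k : ℕ)
    (K : Submodule ℚ (Motives.bettiCohomology X k))
    (hK : K.baseChange ℂ =
      ⨆ pq : ↥(Finset.antidiagonal k), K.baseChange ℂ ⊓ A.ratPiece hX k pq.1.1 pq.1.2) :
    ∃ S : (A.hodgeStructure hX hA k).SubHodgeStructure, S.toSubmodule = K := by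
  refine Motives.HodgeStructure.SubHodgeStructure.exists_eq_of_baseChange_le K ?_
  conv_lhs => rw [hK]
  refine iSup_le fun pq ↦ ?_
  obtain ⟨⟨p, q⟩, hpq⟩ := pq
  have hpq' : p + q = k := Finset.mem_antidiagonal.1 hpq
  refine le_iSup_of_le (p : ℤ) ?_
  have hkp : (k : ℤ) - p = (q : ℤ) := by omega
  rw [hkp, A.piece_eq_ratPiece hX hA hpq']

/-- **Transport of "stable under the decomposition into types" from the model to `K ⊗ ℂ`**: if the
pull-back `W' ⊆ Hᵏ(X^an; ℂ)` of `W = β(K ⊗ ℂ) ⊆ Hᵏ(X(ℂ); ℂ)` satisfies `W' = ⨁ W' ∩ H^{p,q}` (the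
predicate `HodgeModel.IsSubHodge A k W'` of the barrier catalogue, unfolded), then
`K ⊗ ℂ = ⨁ (K ⊗ ℂ) ∩ Θ_A⁻¹(H^{p,q})` (preimages along the isomorphism `Θ_A = (pull-back) ∘ β`
commute with sums and intersections). [cite: VoisinHodgeI2002, §7.3.1] -/
theorem baseChange_eq_iSup_of_map_pullback (k : ℕ) (K : Submodule ℚ (Motives.bettiCohomology X k))
    (hK : ((K.baseChange ℂ).map (ofRatClassBaseChange (Motives.ComplexPoints X) k)).map
        (A.pullback k).hom =
      ⨆ (p : ℕ) (q : ℕ) (_ : p + q = k),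
        ((K.baseChange ℂ).map (ofRatClassBaseChange (Motives.ComplexPoints X) k)).map
          (A.pullback k).hom ⊓ A.hodgePQ k p q) :
    K.baseChange ℂ = ⨆ pq : ↥(Finset.antidiagonal k), K.baseChange ℂ ⊓ A.ratPiece hX k pq.1.1 pq.1.2 := by
  -- `map (pull-back) ∘ map β = map Θ_A`
  have hΘ : ((K.baseChange ℂ).map (ofRatClassBaseChange (Motives.ComplexPoints X) k)).map
      (A.pullback k).hom = (K.baseChange ℂ).map (A.complexification hX k).toLinearMap := by
    rw [← Submodule.map_comp]
    rfl
  rw [hΘ] at hK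
  have hinj : Function.Injective (A.complexification hX k).toLinearMap :=
    (A.complexification hX k).injective
  apply_fun Submodule.comap (A.complexification hX k).toLinearMap at hK
  rw [Submodule.comap_map_eq_of_injective hinj] at hK
  conv_lhs => rw [hK]
  rw [iSup_antidiagonal_eq_iSup k fun p q ↦ K.baseChange ℂ ⊓ A.ratPiece hX k p q]
  -- `comap Θ_A` (= `map Θ_A⁻¹`) distributes over `⨆` and `⊓`
  simp only [Submodule.comap_equiv_eq_map_symm, Submodule.map_iSup]
  simp only [← Submodule.comap_equiv_eq_map_symm, Submodule.comap_inf,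
    Submodule.comap_map_eq_of_injective hinj]
  rfl

/-- **The rational classes supported on `Z` underlie a sub-Hodge structure, GIVEN Deligne's theorem
in the complexified per-kernel form of the barrier catalogue** (`hZ`, verbatim the unfolded
`HodgeModel.IsSubHodge A k (W.map (A.pullback k))` with `W` the span of the RATIONAL classes of
`Hᵏ(X(ℂ); ℂ)` killed by restriction to `(X ∖ Z)(ℂ)` — Voisin 2014, Thm. 2.39 (Deligne) for `Z`
Zariski closed). That span is `classesSupportedOn X Z k` (universal coefficients,
`span_rational_classesSupportedOn`), which is `β` of the complexified rational kernel
(`map_baseChange_ratClassesSupportedOn`); conclude by `baseChange_eq_iSup_of_map_pullback` and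
`exists_subHodgeStructure_of_decomposition`. [cite: VoisinChowRings2014, Thm. 2.39]
[cite: DeligneHodgeII1971, Cor. 3.2.17] [cite: GrothendieckTopology1969, p. 300] -/
theorem exists_subHodgeStructure_ratClassesSupportedOn_of_model (hA : A.IsHodgeSymmetric) (k : ℕ)
    (Z : Set X.left)
    (hZ : (Submodule.span ℂ {x : complexBetti X k |
          IsRationalClass x ∧ complexBetti.restrictCompl X Z k x = 0}).map (A.pullback k).hom =
      ⨆ (p : ℕ) (q : ℕ) (_ : p + q = k),
        (Submodule.span ℂ {x : complexBetti X k |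
            IsRationalClass x ∧ complexBetti.restrictCompl X Z k x = 0}).map (A.pullback k).hom ⊓
          A.hodgePQ k p q) :
    ∃ S : (A.hodgeStructure hX hA k).SubHodgeStructure,
      S.toSubmodule = ratClassesSupportedOn X Z k := by
  rw [span_rational_classesSupportedOn hX Z k, ← map_baseChange_ratClassesSupportedOn hX Z k] at hZ
  exact A.exists_subHodgeStructure_of_decomposition hX hA k _
    (A.baseChange_eq_iSup_of_map_pullback hX k _ hZ)

end HodgeModel

end HodgeTheory

end Literature.AlgebraicGeometry.HodgeTheory

end
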